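import Literature.AlgebraicGeometry.Resolution.JoinRationalMap
import Literature.AlgebraicGeometry.Resolution.RationalFunctionsToProjectiveSpaceConverse
import HarnessLib

/-!
# The ruled-join morphism on field-valued points: `((x : u), (y : v)) ↦ (s x : t y)`

Topic: `Literature/AlgebraicGeometry/Resolution`. Sequel to `Resolution/JoinRationalMap`
(Shioda–Katsura's rational map `((x:u),(y:v)) ↦ (v x : u y)` as the morphism
`RuledJoin.joinMap : Z → ℙᴺ_k`, `N + 1 = (a+1)+(b+1)`, of the vector `ζ` of rational functions).
Here we READ IT ON `L`-VALUED POINTS (`L ⊇ k` a field) in homogeneous coordinates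
(`Motives.ProjectiveSpace.pointOfVec`): if an `L`-point `κ` of `Z` has images `(x₀ : … : x_a : u)`
and `(y₀ : … : y_b : v)` in the two projective spaces and lies in an open `W` over
`D₊(xᵢ) × D₊(y_j)` carrying a section `T` with rational function `[u/xᵢ]/[v/y_j]` (on the blow-up
of `{u = 0} × {v = 0}`: the exceptional coordinate), then
`joinMap(κ) = (x₀ : … : x_a : T(κ)·(xᵢ/y_j)·y₀ : … )`, i.e. **`joinMap(κ) = (s x : t y)` with
`(s : t) = (1/xᵢ : T(κ)/y_j)`** (`comp_joinMap_eq_pointOfVec_of_inl`; mirror statement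
`…_of_inr` on the other kind of chart, and the coordinate-free corollary
`exists_comp_joinMap_eq_pointOfVec`). This is the classical description of the ruled join:
the point of the line joining `(x : 0)` and `(0 : y)` with parameter `(s : t)`
(Shioda, Math. Ann. 245 (1979), proof of Thm. I; Harris, *Algebraic Geometry*, Ex. 8.1).

Ingredients: `comp_toProjOfVec_eq_chartPoint` (`RationalFunctionsToProjectiveSpace`), the
values of the pulled-back coordinate ratios `r^*(x_j/xᵢ)` at `L`-points
(`evalAt_homRatio_eq_div`, from `RationalFunctionsToProjectiveSpaceConverse`), and the chart
identities `map_lsRatio_*` of `JoinRationalMap`.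

## References

* T. Shioda, T. Katsura, On Fermat varieties, Tôhoku Math. J. 31 (1979) 97–115, §1 (1.8) and
  Thm. 1.7 (i). [ShiodaKatsura1979]
* T. Shioda, The Hodge conjecture for Fermat varieties, Math. Ann. 245 (1979) 175–184, proof of
  Thm. I. [Shioda1979HodgeFermat]
* R. Hartshorne, *Algebraic Geometry* (1977), II Thm. 7.1. [Hartshorne1977]
-/

noncomputable section

open CategoryTheory CategoryTheory.Limits AlgebraicGeometry TopologicalSpace Opposite
open Literature.AlgebraicGeometry.Motives Literature.AlgebraicGeometry.Motives.Segre
open Literature.AlgebraicGeometry.Motives.RatFn MvPolynomial HomogeneousLocalization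

attribute [local instance] MvPolynomial.gradedAlgebra ProjBaseChange.algebraBase

namespace Literature.AlgebraicGeometry.Resolution

universe u

/-! ## Values of sections at field-valued points -/

section EvalAt

variable {X : Scheme.{u}} {R : CommRingCat.{u}} (κ : Spec R ⟶ X)

/-- `evalAt` is compatible with restriction of the section. [folklore] -/
theorem evalAt_map {V V' : X.Opens} (hV : ⊤ ≤ κ ⁻¹ᵁ V) (hV' : ⊤ ≤ κ ⁻¹ᵁ V') (e : V' ≤ V)
    (s : Γ(X, V)) : evalAt κ V' hV' (X.presheaf.map (homOfLE e).op s) = evalAt κ V hV s := by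
  rw [evalAt, evalAt, GeneratingSections.res_map κ V hV hV' e s]

/-- `evalAt` is multiplicative. [folklore] -/
theorem evalAt_mul {V : X.Opens} (hV : ⊤ ≤ κ ⁻¹ᵁ V) (s t : Γ(X, V)) :
    evalAt κ V hV (s * t) = evalAt κ V hV s * evalAt κ V hV t := by
  rw [evalAt, evalAt, evalAt, map_mul, map_mul]

variable {n : ℕ} {k : Type u} [Field k] (r : X ⟶ Proj (grading (Fin (n + 1)) k))
  {L : Type u} [Field L] [Algebra k L]

/-- **The value of `r^*(x_j/xᵢ)` at an `L`-point with image `(z₀ : … : zₙ)` is `z_j/zᵢ`**: for an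
`L`-point `κ` of `X` landing in `r⁻¹D₊(xᵢ)` with `κ ≫ r = pointOfVec k z`
(`evalAt_comp_ι_homRatio_of_comp_eq` with the evaluation chart map `awayEval z`).
[cite: Hartshorne1977, II Thm. 7.1 (a)] -/
theorem evalAt_homRatio_eq_div (κ : Spec (.of L) ⟶ X) {i : Fin (n + 1)}
    (hκ : ⊤ ≤ κ ⁻¹ᵁ GeneratingSections.preU r i) (z : Fin (n + 1) → L) (hz : z ≠ 0)
    (hr : κ ≫ r = (ProjectiveSpace.pointOfVec k z hz).left) (j : Fin (n + 1)) :
    evalAt κ (GeneratingSections.preU r i) hκ (GeneratingSections.homRatio r i j) = z j / z i := by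
  set U := GeneratingSections.preU r i with hU
  -- `zᵢ ≠ 0`: the point lies in `D₊(xᵢ)`
  have hpt : (ProjectiveSpace.pointOfVec k z hz).pt = r (κ (IsLocalRing.closedPoint L)) := by
    have := congrArg (fun φ => φ (IsLocalRing.closedPoint L)) hr
    simp only [Scheme.Hom.comp_apply] at this
    exact this.symm
  have hi : z i ≠ 0 := by
    rw [← ProjectiveSpace.pt_pointOfVec_mem_basicOpen_X_iff (k := k) z hz i, hpt]
    exact hκ (Set.mem_univ _)
  have hzi : aeval z (MvPolynomial.X i : MvPolynomial _ k) ≠ 0 := by rwa [aeval_X]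
  -- lift `κ` through the open `U`
  have hrange : Set.range κ ⊆ Set.range U.ι := by
    rw [Scheme.Opens.range_ι]
    rintro _ ⟨p, rfl⟩
    exact hκ (Set.mem_univ p)
  let κ' := IsOpenImmersion.lift U.ι κ hrange
  have hκ' : κ' ≫ U.ι = κ := IsOpenImmersion.lift_fac _ _ _
  have h : ⊤ ≤ (κ' ≫ U.ι) ⁻¹ᵁ U := by rw [hκ']; exact hκ
  have he : (κ' ≫ U.ι) ≫ r =
      Spec.map (CommRingCat.ofHom (ProjectiveSpace.awayEval z hzi).toRingHom) ≫ chartι k i := by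
    rw [hκ', hr, ProjectiveSpace.pointOfVec_eq_chartPoint z hz (Segre.X_mem k i) one_pos hzi]
    rfl
  rw [← evalAt_congr hκ' U h hκ, evalAt_comp_ι_homRatio_of_comp_eq r κ' h _ he j]
  show ProjectiveSpace.awayEval z hzi (frac k i j) = z j / z i
  rw [show frac k i j = Away.mk _ (Segre.X_mem k i) 1 (MvPolynomial.X j ^ 1)
      (by simpa using Segre.X_mem k j) from rfl,
    ProjectiveSpace.awayEval_mk z hzi (Segre.X_mem k i), pow_one, pow_one, aeval_X, aeval_X]

end EvalAt

/-! ## `joinMap` on `L`-points -/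

namespace RuledJoin

variable {k : Type u} [Field k] {Z : Scheme.{u}} [IsIntegral Z] {a b : ℕ}
  (g₁ : Z ⟶ Proj (grading (Fin (a + 2)) k)) (g₂ : Z ⟶ Proj (grading (Fin (b + 2)) k))
  {i₀ : Fin (a + 2)} {j₀ : Fin (b + 2)}
  (h₁ : genericPoint Z ∈ GeneratingSections.preU g₁ i₀)
  (h₂ : genericPoint Z ∈ GeneratingSections.preU g₂ j₀) {N : ℕ} (hN : N + 1 = (a + 1) + (b + 1))
  (hu : genericPoint Z ∈ GeneratingSections.preU g₁ (Fin.last (a + 1)))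
  (hv : genericPoint Z ∈ GeneratingSections.preU g₂ (Fin.last (b + 1)))
  (hZ : ∀ z : Z, ∃ (i : Fin (a + 1)) (j : Fin (b + 1)),
    z ∈ GeneratingSections.preU g₁ i.castSucc ∧ z ∈ GeneratingSections.preU g₂ j.castSucc ∧
    (IsRegularAt z ((coordFn g₁ h₁ (Fin.last (a + 1)) / coordFn g₁ h₁ i.castSucc) /
        (coordFn g₂ h₂ (Fin.last (b + 1)) / coordFn g₂ h₂ j.castSucc)) ∨
      IsRegularAt z ((coordFn g₂ h₂ (Fin.last (b + 1)) / coordFn g₂ h₂ j.castSucc) /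
        (coordFn g₁ h₁ (Fin.last (a + 1)) / coordFn g₁ h₁ i.castSucc))))
  (f : Z ⟶ Spec (.of k)) {L : Type u} [Field L] [Algebra k L] (κ : Spec (.of L) ⟶ Z)
  (hκf : κ ≫ f = Spec.map (CommRingCat.ofHom (algebraMap k L)))

include hv in
/-- An open carrying a section with rational function `[u/xᵢ]/[v/y_j]` lies in the chart of
`v·xᵢ`. [folklore] -/
theorem le_lsChart_inl {W : Z.Opens} {i : Fin (a + 1)} {j : Fin (b + 1)}
    (hW₁ : W ≤ GeneratingSections.preU g₁ i.castSucc) (hW₂ : W ≤ GeneratingSections.preU g₂ j.castSucc)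
    (hη : genericPoint Z ∈ W) (T : Γ(Z, W))
    (hT : ofSection hη T = (coordFn g₁ h₁ (Fin.last (a + 1)) / coordFn g₁ h₁ i.castSucc) /
      (coordFn g₂ h₂ (Fin.last (b + 1)) / coordFn g₂ h₂ j.castSucc)) :
    W ≤ lsChart (joinRatFn g₁ g₂ h₁ h₂ hN) (inl hN i) := fun z hz ↦
  mem_lsChart_inl g₁ g₂ h₁ h₂ hN hv (hW₁ hz) (hW₂ hz)
    (by rw [← hT, ofSection_eq_toFunctionField hz]; exact isRegularAt_germ hz T)

include hu in
/-- An open carrying a section with rational function `[v/y_j]/[u/xᵢ]` lies in the chart of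
`u·y_j`. [folklore] -/
theorem le_lsChart_inr {W : Z.Opens} {i : Fin (a + 1)} {j : Fin (b + 1)}
    (hW₁ : W ≤ GeneratingSections.preU g₁ i.castSucc) (hW₂ : W ≤ GeneratingSections.preU g₂ j.castSucc)
    (hη : genericPoint Z ∈ W) (T' : Γ(Z, W))
    (hT' : ofSection hη T' = (coordFn g₂ h₂ (Fin.last (b + 1)) / coordFn g₂ h₂ j.castSucc) /
      (coordFn g₁ h₁ (Fin.last (a + 1)) / coordFn g₁ h₁ i.castSucc)) :
    W ≤ lsChart (joinRatFn g₁ g₂ h₁ h₂ hN) (inr hN j) := fun z hz ↦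
  mem_lsChart_inr g₁ g₂ h₁ h₂ hN hu (hW₁ hz) (hW₂ hz)
    (by rw [← hT', ofSection_eq_toFunctionField hz]; exact isRegularAt_germ hz T')

/-- The appended vector `(c • x' ; d • y')` does not vanish if `c ≠ 0` and `x'ᵢ ≠ 0`. [folklore] -/
theorem append_smul_ne_zero_left {x' : Fin (a + 1) → L} {y' : Fin (b + 1) → L} {c d : L}
    (hc : c ≠ 0) {i : Fin (a + 1)} (hi : x' i ≠ 0) :
    (Fin.append (c • x') (d • y') ∘ Fin.cast hN : Fin (N + 1) → L) ≠ 0 := fun h0 ↦ by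
  have := congrFun h0 (inl hN i)
  simp only [Function.comp_apply, inl, Pi.zero_apply] at this
  rw [show Fin.cast hN (Fin.cast hN.symm (Fin.castAdd (b + 1) i)) = Fin.castAdd (b + 1) i from rfl,
    Fin.append_left, Pi.smul_apply, smul_eq_mul] at this
  exact mul_ne_zero hc hi this

/-- The appended vector `(c • x' ; d • y')` does not vanish if `d ≠ 0` and `y'_j ≠ 0`. [folklore] -/
theorem append_smul_ne_zero_right {x' : Fin (a + 1) → L} {y' : Fin (b + 1) → L} {c d : L}
    (hd : d ≠ 0) {j : Fin (b + 1)} (hj : y' j ≠ 0) :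
    (Fin.append (c • x') (d • y') ∘ Fin.cast hN : Fin (N + 1) → L) ≠ 0 := fun h0 ↦ by
  have := congrFun h0 (inr hN j)
  simp only [Function.comp_apply, inr, Pi.zero_apply] at this
  rw [show Fin.cast hN (Fin.cast hN.symm (Fin.natAdd (a + 1) j)) = Fin.natAdd (a + 1) j from rfl,
    Fin.append_right, Pi.smul_apply, smul_eq_mul] at this
  exact mul_ne_zero hd hj this

include hκf in
/-- **`joinMap` on an `L`-point of the chart of `v·xᵢ`: `(x : u), (y : v) ↦ (x/xᵢ : (T/y_j)·y)`.**
For an `L`-point `κ` of `Z` in an open `W ⊆ D(xᵢ) ∩ D(y_j)` carrying `T` with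
`[T] = [u/xᵢ]/[v/y_j]`, with images `pointOfVec k x`, `pointOfVec k y` in `ℙ^{a+1}`, `ℙ^{b+1}`,
the image under `joinMap` is the point with homogeneous coordinates
`(xᵢ⁻¹ • (x₀, …, x_a) ; (T(κ)/y_j) • (y₀, …, y_b))`. [cite: ShiodaKatsura1979, §1 (1.8) and Thm. 1.7 (i)]
[cite: Shioda1979HodgeFermat, Thm. I (proof)] -/
theorem comp_joinMap_eq_pointOfVec_of_inl {W : Z.Opens} {i : Fin (a + 1)} {j : Fin (b + 1)}
    (hW₁ : W ≤ GeneratingSections.preU g₁ i.castSucc) (hW₂ : W ≤ GeneratingSections.preU g₂ j.castSucc)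
    (hη : genericPoint Z ∈ W) (T : Γ(Z, W))
    (hT : ofSection hη T = (coordFn g₁ h₁ (Fin.last (a + 1)) / coordFn g₁ h₁ i.castSucc) /
      (coordFn g₂ h₂ (Fin.last (b + 1)) / coordFn g₂ h₂ j.castSucc))
    (hκW : ⊤ ≤ κ ⁻¹ᵁ W) (x : Fin (a + 2) → L) (hx : x ≠ 0)
    (hκ₁ : κ ≫ g₁ = (ProjectiveSpace.pointOfVec k x hx).left) (y : Fin (b + 2) → L) (hy : y ≠ 0)
    (hκ₂ : κ ≫ g₂ = (ProjectiveSpace.pointOfVec k y hy).left)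
    (hxi : x i.castSucc ≠ 0) :
    κ ≫ joinMap g₁ g₂ h₁ h₂ hN hu hv hZ f =
      (ProjectiveSpace.pointOfVec k
        (Fin.append ((x i.castSucc)⁻¹ • (x ∘ Fin.castSucc))
          ((evalAt κ W hκW T / y j.castSucc) • (y ∘ Fin.castSucc)) ∘ Fin.cast hN)
        (append_smul_ne_zero_left hN (inv_ne_zero hxi) hxi)).left := by
  have hW := le_lsChart_inl g₁ g₂ h₁ h₂ hN hv hW₁ hW₂ hη T hT
  have hκ' : ⊤ ≤ κ ⁻¹ᵁ lsChart (joinRatFn g₁ g₂ h₁ h₂ hN) (inl hN i) :=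
    hκW.trans (Scheme.Hom.preimage_mono κ hW)
  have hκ₁' : ⊤ ≤ κ ⁻¹ᵁ GeneratingSections.preU g₁ i.castSucc :=
    hκW.trans (Scheme.Hom.preimage_mono κ hW₁)
  have hκ₂' : ⊤ ≤ κ ⁻¹ᵁ GeneratingSections.preU g₂ j.castSucc :=
    hκW.trans (Scheme.Hom.preimage_mono κ hW₂)
  rw [joinMap, comp_toProjOfVec_eq_chartPoint _ f _ κ hκf hκ']
  -- the vector of values of the ratio sections is the displayed vector
  set v : Fin (N + 1) → L := Fin.append ((x i.castSucc)⁻¹ • (x ∘ Fin.castSucc))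
    ((evalAt κ W hκW T / y j.castSucc) • (y ∘ Fin.castSucc)) ∘ Fin.cast hN with hvdef
  have hw : (fun l => evalAt κ (lsChart (joinRatFn g₁ g₂ h₁ h₂ hN) (inl hN i)) hκ'
      (lsRatio (joinRatFn g₁ g₂ h₁ h₂ hN) (inl hN i) l)) = v := by
    funext l
    rw [← evalAt_map κ hκ' hκW hW]
    rcases inl_or_inr hN l with ⟨i', rfl⟩ | ⟨j', rfl⟩
    · rw [map_lsRatio_inl_inl g₁ g₂ h₁ h₂ hN hv hW₁ hW hη i', evalAt_map κ hκ₁' hκW hW₁,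
        evalAt_homRatio_eq_div g₁ κ hκ₁' x hx hκ₁]
      simp only [hvdef, Function.comp_apply, inl]
      rw [show Fin.cast hN (Fin.cast hN.symm (Fin.castAdd (b + 1) i')) = Fin.castAdd (b + 1) i'
          from rfl, Fin.append_left]
      simp only [Pi.smul_apply, Function.comp_apply, smul_eq_mul]
      rw [div_eq_inv_mul]
    · rw [map_lsRatio_inl_inr g₁ g₂ h₁ h₂ hN hv hW₁ hW₂ hW hη T hT j', evalAt_mul,
        evalAt_map κ hκ₂' hκW hW₂, evalAt_homRatio_eq_div g₂ κ hκ₂' y hy hκ₂]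
      simp only [hvdef, Function.comp_apply, inr]
      rw [show Fin.cast hN (Fin.cast hN.symm (Fin.natAdd (a + 1) j')) = Fin.natAdd (a + 1) j'
          from rfl, Fin.append_right]
      simp only [Pi.smul_apply, Function.comp_apply, smul_eq_mul]
      rw [mul_div_assoc', div_mul_eq_mul_div]
  have hvt : aeval v (MvPolynomial.X (inl hN i) : MvPolynomial _ k) ≠ 0 := by
    rw [← hw]; exact aeval_evalAt_ne_zero _ κ hκ'
  rw [ProjectiveSpace.pointOfVec_eq_chartPoint v _ (Segre.X_mem k (inl hN i)) one_pos hvt]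
  congr 2

include hκf in
/-- **`joinMap` on an `L`-point of the chart of `u·y_j`: `(x : u), (y : v) ↦ ((T'/xᵢ)·x : y/y_j)`**,
`[T'] = [v/y_j]/[u/xᵢ]`. [cite: ShiodaKatsura1979, §1 (1.8) and Thm. 1.7 (i)]
[cite: Shioda1979HodgeFermat, Thm. I (proof)] -/
theorem comp_joinMap_eq_pointOfVec_of_inr {W : Z.Opens} {i : Fin (a + 1)} {j : Fin (b + 1)}
    (hW₁ : W ≤ GeneratingSections.preU g₁ i.castSucc) (hW₂ : W ≤ GeneratingSections.preU g₂ j.castSucc)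
    (hη : genericPoint Z ∈ W) (T' : Γ(Z, W))
    (hT' : ofSection hη T' = (coordFn g₂ h₂ (Fin.last (b + 1)) / coordFn g₂ h₂ j.castSucc) /
      (coordFn g₁ h₁ (Fin.last (a + 1)) / coordFn g₁ h₁ i.castSucc))
    (hκW : ⊤ ≤ κ ⁻¹ᵁ W) (x : Fin (a + 2) → L) (hx : x ≠ 0)
    (hκ₁ : κ ≫ g₁ = (ProjectiveSpace.pointOfVec k x hx).left) (y : Fin (b + 2) → L) (hy : y ≠ 0)
    (hκ₂ : κ ≫ g₂ = (ProjectiveSpace.pointOfVec k y hy).left)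
    (hyj : y j.castSucc ≠ 0) :
    κ ≫ joinMap g₁ g₂ h₁ h₂ hN hu hv hZ f =
      (ProjectiveSpace.pointOfVec k
        (Fin.append ((evalAt κ W hκW T' / x i.castSucc) • (x ∘ Fin.castSucc))
          ((y j.castSucc)⁻¹ • (y ∘ Fin.castSucc)) ∘ Fin.cast hN)
        (append_smul_ne_zero_right hN (inv_ne_zero hyj) hyj)).left := by
  have hW := le_lsChart_inr g₁ g₂ h₁ h₂ hN hu hW₁ hW₂ hη T' hT'
  have hκ' : ⊤ ≤ κ ⁻¹ᵁ lsChart (joinRatFn g₁ g₂ h₁ h₂ hN) (inr hN j) :=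
    hκW.trans (Scheme.Hom.preimage_mono κ hW)
  have hκ₁' : ⊤ ≤ κ ⁻¹ᵁ GeneratingSections.preU g₁ i.castSucc :=
    hκW.trans (Scheme.Hom.preimage_mono κ hW₁)
  have hκ₂' : ⊤ ≤ κ ⁻¹ᵁ GeneratingSections.preU g₂ j.castSucc :=
    hκW.trans (Scheme.Hom.preimage_mono κ hW₂)
  rw [joinMap, comp_toProjOfVec_eq_chartPoint _ f _ κ hκf hκ']
  set v : Fin (N + 1) → L := Fin.append ((evalAt κ W hκW T' / x i.castSucc) • (x ∘ Fin.castSucc))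
    ((y j.castSucc)⁻¹ • (y ∘ Fin.castSucc)) ∘ Fin.cast hN with hvdef
  have hw : (fun l => evalAt κ (lsChart (joinRatFn g₁ g₂ h₁ h₂ hN) (inr hN j)) hκ'
      (lsRatio (joinRatFn g₁ g₂ h₁ h₂ hN) (inr hN j) l)) = v := by
    funext l
    rw [← evalAt_map κ hκ' hκW hW]
    rcases inl_or_inr hN l with ⟨i', rfl⟩ | ⟨j', rfl⟩
    · rw [map_lsRatio_inr_inl g₁ g₂ h₁ h₂ hN hu hW₁ hW₂ hW hη T' hT' i', evalAt_mul,
        evalAt_map κ hκ₁' hκW hW₁, evalAt_homRatio_eq_div g₁ κ hκ₁' x hx hκ₁]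
      simp only [hvdef, Function.comp_apply, inl]
      rw [show Fin.cast hN (Fin.cast hN.symm (Fin.castAdd (b + 1) i')) = Fin.castAdd (b + 1) i'
          from rfl, Fin.append_left]
      simp only [Pi.smul_apply, Function.comp_apply, smul_eq_mul]
      rw [mul_div_assoc', div_mul_eq_mul_div]
    · rw [map_lsRatio_inr_inr g₁ g₂ h₁ h₂ hN hu hW₂ hW hη j', evalAt_map κ hκ₂' hκW hW₂,
        evalAt_homRatio_eq_div g₂ κ hκ₂' y hy hκ₂]
      simp only [hvdef, Function.comp_apply, inr]
      rw [show Fin.cast hN (Fin.cast hN.symm (Fin.natAdd (a + 1) j')) = Fin.natAdd (a + 1) j'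
          from rfl, Fin.append_right]
      simp only [Pi.smul_apply, Function.comp_apply, smul_eq_mul]
      rw [div_eq_inv_mul]
  have hvt : aeval v (MvPolynomial.X (inr hN j) : MvPolynomial _ k) ≠ 0 := by
    rw [← hw]; exact aeval_evalAt_ne_zero _ κ hκ'
  rw [ProjectiveSpace.pointOfVec_eq_chartPoint v _ (Segre.X_mem k (inr hN j)) one_pos hvt]
  congr 2

end RuledJoin

end Literature.AlgebraicGeometry.Resolution

end
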